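import Literature.AlgebraicGeometry.Motives.HodgeThetaSubalgebraUnitary
import HarnessLib

/-!
# The commutant of the Hodge Lie algebra preserves the eigenspaces of a central Hodge endomorphism: no non-zero intertwiner between two eigenspaces `W_μ`, `W_ν` of `φ_ℂ` (Moonen–Zarhin 1999, proof of Lemma (3.4): the summands `U_j` are pairwise non-isomorphic `hg_ℂ`-modules)

Family `hodge`, layer `Literature/AlgebraicGeometry/Motives` (abstract polarizable `ℚ`-Hodge structures; no geometry),
namespace `Literature.AlgebraicGeometry.Motives.HodgeStructure`, grouping sub-namespace `CentralEigen`. THEOREMS ONLY (no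
definition, no named fact, no `sorry`). Written for the cell `pub-hodgeav-hg6` (req-37 (A) Q2b, eng-4 g7; lead g2
2026-08-29T00:51:12Z (3) and eng-4 g6's typed successor note `hom_eigW_eigWbar_eq_zero_of_commute_hodgeLieC`): the GEOMETRIC
half of the (3|3)-square's WEIL LEG in Hodge-structure vocabulary — «`End_Hdg(V) = K = ℚ(φ)` ⟹ `Hom_𝔊(W, W̄) = 0` for
`𝔊 = (Lie Hg)_ℂ` (or any admissible `𝔤_ℂ ∋ Θ`), `W`, `W̄` the two eigenspaces of `φ_ℂ`», which is the input `hHom` of the tree's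
abstract half `Literature.Algebra.Lie.no_nondegenerate_invariant_form_of_forall_intertwiner_eq_zero` (W3). HONEST FRAMING:
nothing here proves HC / HC_AV / HC_CM; unconditional linear algebra of Hodge structures, no step towards a summit statement.

THE PRINT. B. Moonen, Yu. Zarhin, *Hodge classes on abelian varieties of low dimension*, Math. Ann. 315 (1999), proof of Lemma
(3.4) [held `paper:arxiv-math_9901113` p. 6]: «Write `D = End⁰(X)` and `F = Cent(D)`; set `e = [F : ℚ]` and `d² = dim_F(D)`. … There
are irreducible `hg(X)_ℂ`-modules `U_1, …, U_e`, PAIRWISE NON-ISOMORPHIC, such that `V_X ⊗_ℚ ℂ ≅ U_1^d ⊕ ⋯ ⊕ U_e^d` as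
`hg(X)_ℂ`-modules.» (For `D = F = K` imaginary quadratic: `e = 2`, `d = 1`, `V_ℂ = W ⊕ W̄`.) The mechanism is the commutant
theorem `End_{hg}(V) = End_Hdg(V)` (Deligne, LNM 900, I Prop. 3.4 / 3.6; Zarhin 1983 §2; the tree's
`mem_span_endAlg_of_forall_commute`, `ThetaSubalgebra.mem_span_endAlg_of_forall_commute`) read on the eigenspaces of a
Hodge endomorphism `φ` CENTRAL in `End_Hdg(V)` (F. Hazama, Tôhoku Math. J. 35 (1983) §3: the `V_i` are «mutually
non-isomorphic» `𝔥`-modules). The tree's `Motives/HodgeLieCommutantBlocks` states the same for the eigenBLOCKS `T_σ` of the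
characters `σ : End_Hdg → ℂ`; here the blocks are replaced by the eigenspaces `ker(φ_ℂ - μ)` of ONE central `φ`, the
vocabulary of the cell's unitary / Weil files (`Motives/HodgeThetaSubalgebraUnitary`, `UnitaryTheta.*`), and the operator
`T` is only asked to intertwine ON `W` (not to commute globally) in §2.

CONTENT.
* §1 (any weight, any `φ` commuting with `End_Hdg(V)`): an element of `End_Hdg ⊗ ℂ` commutes with `φ_ℂ`
  (`CentralEigen.commute_baseChange_of_mem_span_endAlg`); hence so does every operator commuting with an admissible `𝔤`
  (`Θ ∈ 𝔤_ℂ`) or with `Lie Hg` / `(Lie Hg)_ℂ`, and such an operator preserves every eigenspace `ker(φ_ℂ - μ)`; so an operator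
  commuting with `𝔤` and carrying `ker(φ_ℂ - μ)` into `ker(φ_ℂ - ν)`, `μ ≠ ν`, VANISHES on `ker(φ_ℂ - μ)`
  (**`CentralEigen.eq_zero_of_forall_commute_of_mapsTo_eigenspace`**, `…_hodgeLie_…`, **`…_hodgeLieC_…`**).
* §2 (`φ² = -d`, `d > 0`, `μ² = -d`, so `V_ℂ = W ⊕ W̄`, `W = ker(φ_ℂ - μ)`, `W̄ = ker(φ_ℂ + μ)`): the LOCAL form — an operator
  which intertwines the `X_ℂ`, `X ∈ 𝔤`, ON `W` only and carries `W` into `W̄` vanishes on `W`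
  (**`CentralEigen.eq_zero_of_forall_apply_comm_of_mapsTo_eigenspace_neg`**; the projector `(μ + φ_ℂ)/2μ` onto `W` along `W̄`
  is a polynomial in `φ_ℂ`), and the LINEAR-MAP form literally consumable as the hypothesis `hHom` of W3: every `ℂ`-linear
  `f : W → W̄` with `f(X_ℂ w) = X_ℂ f(w)` is `0` (**`CentralEigen.linearMap_eigenspace_eq_zero`**), also for `𝔤 = Lie Hg`
  (`CentralEigen.linearMap_eigenspace_eq_zero_hodgeLie`) and with `End_Hdg = ℚ + ℚφ` discharging the centrality of `φ`
  (`CentralEigen.linearMap_eigenspace_eq_zero_of_endAlg_eq`).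
NOT here: the polarization duality `W̄ ≅ W^*` and the «no invariant form» conclusion (next file), irreducibility of `W`
(in the tree: `UnitaryTheta.eq_bot_or_eq_of_stable`), anything about abelian varieties.

## References

* [MoonenZarhin1999LowDim] B. Moonen, Yu. Zarhin, Math. Ann. 315 (1999) 711–733 = arXiv:math/9901113, §3, proof of Lemma (3.4).
* [Hazama1983] F. Hazama, Tôhoku Math. J. 35 (1983) 303–308, §3 p. 305.
* [Deligne1982HodgeCycles] P. Deligne, *Hodge cycles on abelian varieties*, LNM 900 (1982), I §3 Prop. 3.4, §4 p. 30.
* [Zarhin1983HodgeGroupsK3] Yu. G. Zarhin, J. reine angew. Math. 341 (1983), §2.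
* [Gordon1997] B. B. Gordon, arXiv:alg-geom/9709030, §6 (proof of Thm. 6.3.3, p. 19: `W ⊗ ℂ = W′ ⊕ W″`).
-/

noncomputable section

open scoped TensorProduct

namespace Literature.AlgebraicGeometry.Motives

namespace HodgeStructure

universe u

variable {V : Type u} [AddCommGroup V] [Module ℚ V] {n : ℤ}

/-! ### §1 The commutant of `𝔤` commutes with `φ_ℂ` for `φ` central in `End_Hdg(V)` and preserves its eigenspaces -/

section Global

/-- Two eigenspaces of one operator for distinct eigenvalues meet in `0`. [folklore] -/
private theorem CentralEigen.eq_zero_of_mem_eigenspace_of_mem_eigenspace {f : Module.End ℂ (ℂ ⊗[ℚ] V)} {μ ν : ℂ}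
    (hμν : μ ≠ ν) {x : ℂ ⊗[ℚ] V} (hμ : x ∈ Module.End.eigenspace f μ) (hν : x ∈ Module.End.eigenspace f ν) : x = 0 := by
  rw [Module.End.mem_eigenspace_iff] at hμ hν
  have h : (μ - ν) • x = 0 := by rw [sub_smul, ← hμ, ← hν, sub_self]
  exact (smul_eq_zero.1 h).resolve_left (sub_ne_zero.2 hμν)

/-- **An element of `End_Hdg(V) ⊗ ℂ = span_ℂ {a_ℂ : a ∈ End_Hdg(V)}` commutes with `φ_ℂ` when `φ` commutes with every Hodge
endomorphism** (e.g. `φ` central in `End_Hdg(V)`; Deligne §4: the decomposition `H¹ ⊗ ℂ = ⊕_σ H¹_σ` under the centre).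
[cite: Deligne1982HodgeCycles, §4 (p. 30)] -/
theorem CentralEigen.commute_baseChange_of_mem_span_endAlg (H : HodgeStructure V n) {φ : Module.End ℚ V}
    (hφ : ∀ a ∈ H.endAlg, a * φ = φ * a) {T : Module.End ℂ (ℂ ⊗[ℚ] V)}
    (hT : T ∈ Submodule.span ℂ ((fun a : Module.End ℚ V => a.baseChange ℂ) '' (H.endAlg : Set _))) :
    T * φ.baseChange ℂ = φ.baseChange ℂ * T := by
  induction hT using Submodule.span_induction with
  | mem Z hZ =>
    obtain ⟨a, ha, rfl⟩ := hZ
    rw [← LinearMap.baseChange_mul, hφ a ha, LinearMap.baseChange_mul]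
  | zero => rw [zero_mul, mul_zero]
  | add Z Z' _ _ hZ hZ' => rw [add_mul, mul_add, hZ, hZ']
  | smul c Z _ hZ => rw [smul_mul_assoc, mul_smul_comm, hZ]

variable [Module.Finite ℚ V]

/-- **An operator commuting with an admissible `𝔤` (`Θ ∈ 𝔤_ℂ`) commutes with `φ_ℂ`** for `φ` commuting with `End_Hdg(V)`:
it lies in `End_Hdg ⊗ ℂ` by the commutant theorem `ThetaSubalgebra.mem_span_endAlg_of_forall_commute` (Deligne I Prop. 3.4;
Zarhin §2). [cite: Deligne1982HodgeCycles, I §3 Prop. 3.4] [cite: Zarhin1983HodgeGroupsK3, §2] -/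
theorem CentralEigen.commute_baseChange_of_forall_commute (H : HodgeStructure V n) (𝔤 : Submodule ℚ (Module.End ℚ V))
    {Θ : Module.End ℂ (ℂ ⊗[ℚ] V)} (hΘ : ∀ p, ∀ x ∈ H.piece p (n - p), Θ x = ((2 * p - n : ℤ) : ℂ) • x)
    (hΘ𝔤 : Θ ∈ spanC 𝔤) {φ : Module.End ℚ V} (hφ : ∀ a ∈ H.endAlg, a * φ = φ * a) {T : Module.End ℂ (ℂ ⊗[ℚ] V)}
    (hT : ∀ X ∈ 𝔤, T * X.baseChange ℂ = X.baseChange ℂ * T) : T * φ.baseChange ℂ = φ.baseChange ℂ * T :=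
  CentralEigen.commute_baseChange_of_mem_span_endAlg H hφ (ThetaSubalgebra.mem_span_endAlg_of_forall_commute H 𝔤 hΘ hΘ𝔤 hT)

/-- **The commutant of an admissible `𝔤` preserves every eigenspace `ker(φ_ℂ - μ)`** of a Hodge endomorphism `φ` commuting
with `End_Hdg(V)` (Moonen–Zarhin, proof of (3.4): the summands of `V ⊗ ℂ` under `F = Cent(D)` are `hg_ℂ`-modules and
`End_{hg} = D`). [cite: MoonenZarhin1999LowDim, §3 proof of Lemma (3.4)] [cite: Deligne1982HodgeCycles, I §3 Prop. 3.4] -/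
theorem CentralEigen.apply_mem_eigenspace_of_forall_commute (H : HodgeStructure V n) (𝔤 : Submodule ℚ (Module.End ℚ V))
    {Θ : Module.End ℂ (ℂ ⊗[ℚ] V)} (hΘ : ∀ p, ∀ x ∈ H.piece p (n - p), Θ x = ((2 * p - n : ℤ) : ℂ) • x)
    (hΘ𝔤 : Θ ∈ spanC 𝔤) {φ : Module.End ℚ V} (hφ : ∀ a ∈ H.endAlg, a * φ = φ * a) {T : Module.End ℂ (ℂ ⊗[ℚ] V)}
    (hT : ∀ X ∈ 𝔤, T * X.baseChange ℂ = X.baseChange ℂ * T) {μ : ℂ} {x : ℂ ⊗[ℚ] V}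
    (hx : x ∈ Module.End.eigenspace (φ.baseChange ℂ) μ) : T x ∈ Module.End.eigenspace (φ.baseChange ℂ) μ :=
  UnitaryTheta.apply_mem_eigenspace_of_commute (CentralEigen.commute_baseChange_of_forall_commute H 𝔤 hΘ hΘ𝔤 hφ hT) hx

/-- **No non-zero intertwiner between two eigenspaces of a central Hodge endomorphism commutes with an admissible `𝔤`.**
If `T` commutes with the `X_ℂ`, `X ∈ 𝔤` (`Θ ∈ 𝔤_ℂ`), and carries `ker(φ_ℂ - μ)` into `ker(φ_ℂ - ν)` with `μ ≠ ν`, then `T`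
vanishes on `ker(φ_ℂ - μ)` — the eigenspaces are PAIRWISE NON-ISOMORPHIC `𝔤_ℂ`-modules (Moonen–Zarhin, proof of Lemma (3.4):
«irreducible `hg(X)_ℂ`-modules `U_1, …, U_e`, pairwise non-isomorphic»; Hazama §3). [cite: MoonenZarhin1999LowDim, §3 proof of Lemma (3.4)]
[cite: Hazama1983, §3 (p. 305)] -/
theorem CentralEigen.eq_zero_of_forall_commute_of_mapsTo_eigenspace (H : HodgeStructure V n)
    (𝔤 : Submodule ℚ (Module.End ℚ V)) {Θ : Module.End ℂ (ℂ ⊗[ℚ] V)}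
    (hΘ : ∀ p, ∀ x ∈ H.piece p (n - p), Θ x = ((2 * p - n : ℤ) : ℂ) • x) (hΘ𝔤 : Θ ∈ spanC 𝔤) {φ : Module.End ℚ V}
    (hφ : ∀ a ∈ H.endAlg, a * φ = φ * a) {T : Module.End ℂ (ℂ ⊗[ℚ] V)}
    (hT : ∀ X ∈ 𝔤, T * X.baseChange ℂ = X.baseChange ℂ * T) {μ ν : ℂ} (hμν : μ ≠ ν)
    (hmaps : ∀ x ∈ Module.End.eigenspace (φ.baseChange ℂ) μ, T x ∈ Module.End.eigenspace (φ.baseChange ℂ) ν)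
    {x : ℂ ⊗[ℚ] V} (hx : x ∈ Module.End.eigenspace (φ.baseChange ℂ) μ) : T x = 0 :=
  CentralEigen.eq_zero_of_mem_eigenspace_of_mem_eigenspace hμν
    (CentralEigen.apply_mem_eigenspace_of_forall_commute H 𝔤 hΘ hΘ𝔤 hφ hT hx) (hmaps x hx)

variable [HodgeTensorFacts.{u, u}]

/-- **An operator commuting with `Lie Hg(H)` commutes with `φ_ℂ`** for `φ` commuting with `End_Hdg(V)` (the commutant of
`Lie Hg` is `End_Hdg ⊗ ℂ`, `mem_span_endAlg_of_forall_commute`). [cite: Zarhin1983HodgeGroupsK3, §2]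
[cite: Deligne1982HodgeCycles, I §3 Prop. 3.4] -/
theorem CentralEigen.commute_baseChange_of_forall_commute_hodgeLie (H : HodgeStructure V n) {φ : Module.End ℚ V}
    (hφ : ∀ a ∈ H.endAlg, a * φ = φ * a) {T : Module.End ℂ (ℂ ⊗[ℚ] V)}
    (hT : ∀ X ∈ H.hodgeLie, T * X.baseChange ℂ = X.baseChange ℂ * T) : T * φ.baseChange ℂ = φ.baseChange ℂ * T :=
  CentralEigen.commute_baseChange_of_mem_span_endAlg H hφ (H.mem_span_endAlg_of_forall_commute hT)

/-- **No non-zero intertwiner between two eigenspaces of a central Hodge endomorphism commutes with `Lie Hg(H)`**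
(`𝔤 = Lie Hg`: the eigenspaces `ker(φ_ℂ - μ)`, `ker(φ_ℂ - ν)`, `μ ≠ ν`, are non-isomorphic `Lie Hg`-modules).
[cite: MoonenZarhin1999LowDim, §3 proof of Lemma (3.4)] [cite: Hazama1983, §3 (p. 305)] -/
theorem CentralEigen.eq_zero_of_forall_commute_hodgeLie_of_mapsTo_eigenspace (H : HodgeStructure V n) {φ : Module.End ℚ V}
    (hφ : ∀ a ∈ H.endAlg, a * φ = φ * a) {T : Module.End ℂ (ℂ ⊗[ℚ] V)}
    (hT : ∀ X ∈ H.hodgeLie, T * X.baseChange ℂ = X.baseChange ℂ * T) {μ ν : ℂ} (hμν : μ ≠ ν)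
    (hmaps : ∀ x ∈ Module.End.eigenspace (φ.baseChange ℂ) μ, T x ∈ Module.End.eigenspace (φ.baseChange ℂ) ν)
    {x : ℂ ⊗[ℚ] V} (hx : x ∈ Module.End.eigenspace (φ.baseChange ℂ) μ) : T x = 0 :=
  CentralEigen.eq_zero_of_mem_eigenspace_of_mem_eigenspace hμν
    (UnitaryTheta.apply_mem_eigenspace_of_commute (CentralEigen.commute_baseChange_of_forall_commute_hodgeLie H hφ hT) hx)
    (hmaps x hx)

/-- **No non-zero intertwiner between two eigenspaces of a central Hodge endomorphism commutes with `(Lie Hg)_ℂ`** — the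
form named in the cell's successor note (`hom_eigW_eigWbar_eq_zero_of_commute_hodgeLieC`): `T` commuting with every
`Y ∈ hodgeLieC H` and carrying `ker(φ_ℂ - μ)` into `ker(φ_ℂ - ν)`, `μ ≠ ν`, vanishes on `ker(φ_ℂ - μ)`.
[cite: MoonenZarhin1999LowDim, §3 proof of Lemma (3.4)] [cite: Zarhin1983HodgeGroupsK3, §2] -/
theorem CentralEigen.eq_zero_of_forall_commute_hodgeLieC_of_mapsTo_eigenspace (H : HodgeStructure V n) {φ : Module.End ℚ V}
    (hφ : ∀ a ∈ H.endAlg, a * φ = φ * a) {T : Module.End ℂ (ℂ ⊗[ℚ] V)} (hT : ∀ Y ∈ H.hodgeLieC, T * Y = Y * T)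
    {μ ν : ℂ} (hμν : μ ≠ ν)
    (hmaps : ∀ x ∈ Module.End.eigenspace (φ.baseChange ℂ) μ, T x ∈ Module.End.eigenspace (φ.baseChange ℂ) ν)
    {x : ℂ ⊗[ℚ] V} (hx : x ∈ Module.End.eigenspace (φ.baseChange ℂ) μ) : T x = 0 :=
  CentralEigen.eq_zero_of_forall_commute_hodgeLie_of_mapsTo_eigenspace H hφ
    (fun _ hX => hT _ (H.baseChange_mem_hodgeLieC hX)) hμν hmaps hx

end Global

/-! ### §2 The quadratic case `φ² = -d`: intertwiners ON `W = ker(φ_ℂ - μ)` into `W̄ = ker(φ_ℂ + μ)` vanish -/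

section Quadratic

/-- `φ² = -d` complexified as operators: `φ_ℂ ∘ φ_ℂ = -d`. [cite: MoonenZarhin1999LowDim, §2 (2.3)] -/
private theorem CentralEigen.baseChange_mul_baseChange {φ : Module.End ℚ V} {d : ℚ} (hφ2 : φ * φ = -(d • 1)) :
    φ.baseChange ℂ * φ.baseChange ℂ = -((d : ℂ) • 1) := by
  refine LinearMap.ext fun x => ?_
  rw [Module.End.mul_apply, UnitaryTheta.baseChange_baseChange_apply hφ2, LinearMap.neg_apply, LinearMap.smul_apply,
    Module.End.one_apply]

/-- **The projector onto `W` along `W̄`.** For `φ² = -d`, `μ² = -d`, `μ ≠ 0`, the operator `P = (2μ)⁻¹ (μ + φ_ℂ)` (a polynomial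
in `φ_ℂ`) maps `V_ℂ` into `W = ker(φ_ℂ - μ)`, is the identity on `W`, and `x - P x ∈ W̄ = ker(φ_ℂ + μ)` (Gordon §6:
`W ⊗ ℂ = W′ ⊕ W″`). [cite: Gordon1997, §6 (proof of Thm. 6.3.3, p. 19)] [cite: Deligne1982HodgeCycles, §4 (p. 30)] -/
theorem CentralEigen.projector_facts {φ : Module.End ℚ V} {d : ℚ} (hφ2 : φ * φ = -(d • 1)) {μ : ℂ}
    (hμ : μ ^ 2 = -(d : ℂ)) (hμ0 : μ ≠ 0) :
    (∀ x, ((2 * μ)⁻¹ • (μ • (1 : Module.End ℂ (ℂ ⊗[ℚ] V)) + φ.baseChange ℂ)) x ∈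
        Module.End.eigenspace (φ.baseChange ℂ) μ) ∧
      (∀ w ∈ Module.End.eigenspace (φ.baseChange ℂ) μ,
        ((2 * μ)⁻¹ • (μ • (1 : Module.End ℂ (ℂ ⊗[ℚ] V)) + φ.baseChange ℂ)) w = w) ∧
      (∀ x, x - ((2 * μ)⁻¹ • (μ • (1 : Module.End ℂ (ℂ ⊗[ℚ] V)) + φ.baseChange ℂ)) x ∈
        Module.End.eigenspace (φ.baseChange ℂ) (-μ)) := by
  have hφφ : ∀ x : ℂ ⊗[ℚ] V, φ.baseChange ℂ (φ.baseChange ℂ x) = (μ * μ) • x := fun x => by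
    rw [UnitaryTheta.baseChange_baseChange_apply hφ2, ← sq, hμ, neg_smul]
  have h2μ : (2 * μ)⁻¹ * (μ + μ) = 1 := by rw [← two_mul, inv_mul_cancel₀ (mul_ne_zero two_ne_zero hμ0)]
  refine ⟨fun x => ?_, fun w hw => ?_, fun x => ?_⟩
  · rw [Module.End.mem_eigenspace_iff, LinearMap.smul_apply, LinearMap.add_apply, LinearMap.smul_apply,
      Module.End.one_apply, map_smul, map_add, map_smul, hφφ]
    module
  · rw [Module.End.mem_eigenspace_iff] at hw
    rw [LinearMap.smul_apply, LinearMap.add_apply, LinearMap.smul_apply, Module.End.one_apply, hw, ← add_smul,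
      smul_smul, h2μ, one_smul]
  · rw [Module.End.mem_eigenspace_iff]
    simp only [LinearMap.smul_apply, LinearMap.add_apply, Module.End.one_apply, map_sub, map_smul, map_add, hφφ]
    match_scalars <;> field_simp <;> ring

/-- The projector `P = (2μ)⁻¹ (μ + φ_ℂ)` commutes with every operator commuting with `φ_ℂ`. [folklore] -/
private theorem CentralEigen.projector_comm {φ : Module.End ℚ V} {μ : ℂ} {Y : Module.End ℂ (ℂ ⊗[ℚ] V)}
    (hY : Y * φ.baseChange ℂ = φ.baseChange ℂ * Y) :
    Y * ((2 * μ)⁻¹ • (μ • (1 : Module.End ℂ (ℂ ⊗[ℚ] V)) + φ.baseChange ℂ)) =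
      ((2 * μ)⁻¹ • (μ • (1 : Module.End ℂ (ℂ ⊗[ℚ] V)) + φ.baseChange ℂ)) * Y := by
  rw [mul_smul_comm, smul_mul_assoc, mul_add, add_mul, mul_smul_comm, smul_mul_assoc, mul_one, one_mul, hY]

variable [Module.Finite ℚ V]

/-- **The LOCAL intertwiner lemma (operator form).** `φ ∈ End_Hdg(V)` central with `φ² = -d`, `d > 0`, `μ² = -d`; `𝔤`
admissible (`Θ ∈ 𝔤_ℂ`, `𝔤` commutes with `End_Hdg`). An operator `T` on `V_ℂ` which INTERTWINES the `X_ℂ`, `X ∈ 𝔤`, ON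
`W = ker(φ_ℂ - μ)` (`T (X_ℂ w) = X_ℂ (T w)` for `w ∈ W`; nothing is asked off `W`) and carries `W` into `W̄ = ker(φ_ℂ + μ)`
vanishes on `W`: `T ∘ P` (`P` the projector onto `W` along `W̄`, a polynomial in `φ_ℂ`) commutes with `𝔤` globally, and §1
applies. [cite: MoonenZarhin1999LowDim, §3 proof of Lemma (3.4)] [cite: Gordon1997, §6 (proof of Thm. 6.3.3, p. 19)] -/
theorem CentralEigen.eq_zero_of_forall_apply_comm_of_mapsTo_eigenspace_neg (H : HodgeStructure V n)
    {φ : Module.End ℚ V} (hφE : φ ∈ H.endAlg) (hφ : ∀ a ∈ H.endAlg, a * φ = φ * a) {d : ℚ} (hd : 0 < d)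
    (hφ2 : φ * φ = -(d • 1)) {μ : ℂ} (hμ : μ ^ 2 = -(d : ℂ)) (𝔤 : Submodule ℚ (Module.End ℚ V))
    {Θ : Module.End ℂ (ℂ ⊗[ℚ] V)} (hΘ : ∀ p, ∀ x ∈ H.piece p (n - p), Θ x = ((2 * p - n : ℤ) : ℂ) • x)
    (hΘ𝔤 : Θ ∈ spanC 𝔤) (hcomm : ∀ X ∈ 𝔤, ∀ a : H.endAlg, X * (a : Module.End ℚ V) = (a : Module.End ℚ V) * X)
    {T : Module.End ℂ (ℂ ⊗[ℚ] V)}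
    (hT : ∀ X ∈ 𝔤, ∀ w ∈ Module.End.eigenspace (φ.baseChange ℂ) μ, T (X.baseChange ℂ w) = X.baseChange ℂ (T w))
    (hmaps : ∀ w ∈ Module.End.eigenspace (φ.baseChange ℂ) μ, T w ∈ Module.End.eigenspace (φ.baseChange ℂ) (-μ))
    {w : ℂ ⊗[ℚ] V} (hw : w ∈ Module.End.eigenspace (φ.baseChange ℂ) μ) : T w = 0 := by
  obtain ⟨hμ0, -⟩ := UnitaryTheta.conj_eq_neg_of_sq hd hμ
  obtain ⟨hPmem, hPid, -⟩ := CentralEigen.projector_facts (V := V) hφ2 hμ hμ0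
  set P : Module.End ℂ (ℂ ⊗[ℚ] V) := (2 * μ)⁻¹ • (μ • (1 : Module.End ℂ (ℂ ⊗[ℚ] V)) + φ.baseChange ℂ) with hPdef
  -- `T ∘ P` commutes with `𝔤` globally
  have hTP : ∀ X ∈ 𝔤, (T * P) * X.baseChange ℂ = X.baseChange ℂ * (T * P) := by
    intro X hX
    have hXφ : X.baseChange ℂ * φ.baseChange ℂ = φ.baseChange ℂ * X.baseChange ℂ :=
      UnitaryTheta.baseChange_commute H hφE hcomm hX
    refine LinearMap.ext fun v => ?_
    rw [Module.End.mul_apply, Module.End.mul_apply, Module.End.mul_apply, Module.End.mul_apply,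
      ← Module.End.mul_apply (f := P), ← CentralEigen.projector_comm hXφ, Module.End.mul_apply]
    exact hT X hX _ (hPmem v)
  have hmaps' : ∀ x ∈ Module.End.eigenspace (φ.baseChange ℂ) μ,
      (T * P) x ∈ Module.End.eigenspace (φ.baseChange ℂ) (-μ) := fun x hx => by
    rw [Module.End.mul_apply, hPid x hx]; exact hmaps x hx
  have hne : μ ≠ -μ := fun h => hμ0 (by
    have h2 : (2 : ℂ) * μ = 0 := by rw [two_mul]; nth_rewrite 2 [h]; rw [add_neg_cancel]
    exact (mul_eq_zero.1 h2).resolve_left two_ne_zero)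
  have h := CentralEigen.eq_zero_of_forall_commute_of_mapsTo_eigenspace H 𝔤 hΘ hΘ𝔤 hφ hTP hne hmaps' hw
  rwa [Module.End.mul_apply, hPid w hw] at h

/-- **The LOCAL intertwiner lemma (linear-map form) — the hypothesis `hHom` of
`Literature.Algebra.Lie.no_nondegenerate_invariant_form_of_forall_intertwiner_eq_zero`.** In the setting of the previous
theorem, every `ℂ`-linear `f : W → W̄` which intertwines the restricted actions of the `X_ℂ`, `X ∈ 𝔤` — stated proof-term
free: `f w₁ = X_ℂ (f w)` whenever `w₁ = X_ℂ w` — is ZERO: `Hom_𝔤(W, W̄) = 0` (Moonen–Zarhin: `U_1 = W`, `U_2 = W̄` are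
non-isomorphic `hg_ℂ`-modules). [cite: MoonenZarhin1999LowDim, §3 proof of Lemma (3.4)] [cite: Hazama1983, §3 (p. 305)] -/
theorem CentralEigen.linearMap_eigenspace_eq_zero (H : HodgeStructure V n) {φ : Module.End ℚ V} (hφE : φ ∈ H.endAlg)
    (hφ : ∀ a ∈ H.endAlg, a * φ = φ * a) {d : ℚ} (hd : 0 < d) (hφ2 : φ * φ = -(d • 1)) {μ : ℂ}
    (hμ : μ ^ 2 = -(d : ℂ)) (𝔤 : Submodule ℚ (Module.End ℚ V)) {Θ : Module.End ℂ (ℂ ⊗[ℚ] V)}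
    (hΘ : ∀ p, ∀ x ∈ H.piece p (n - p), Θ x = ((2 * p - n : ℤ) : ℂ) • x) (hΘ𝔤 : Θ ∈ spanC 𝔤)
    (hcomm : ∀ X ∈ 𝔤, ∀ a : H.endAlg, X * (a : Module.End ℚ V) = (a : Module.End ℚ V) * X)
    (f : Module.End.eigenspace (φ.baseChange ℂ) μ →ₗ[ℂ] Module.End.eigenspace (φ.baseChange ℂ) (-μ))
    (hf : ∀ X ∈ 𝔤, ∀ w w₁ : Module.End.eigenspace (φ.baseChange ℂ) μ,
      (w₁ : ℂ ⊗[ℚ] V) = X.baseChange ℂ w → (f w₁ : ℂ ⊗[ℚ] V) = X.baseChange ℂ (f w)) :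
    f = 0 := by
  obtain ⟨hμ0, -⟩ := UnitaryTheta.conj_eq_neg_of_sq hd hμ
  obtain ⟨hPmem, hPid, -⟩ := CentralEigen.projector_facts (V := V) hφ2 hμ hμ0
  set P : Module.End ℂ (ℂ ⊗[ℚ] V) := (2 * μ)⁻¹ • (μ • (1 : Module.End ℂ (ℂ ⊗[ℚ] V)) + φ.baseChange ℂ) with hPdef
  -- extend `f` to `T = ι ∘ f ∘ P` on `V_ℂ`
  set Pc : ℂ ⊗[ℚ] V →ₗ[ℂ] Module.End.eigenspace (φ.baseChange ℂ) μ := LinearMap.codRestrict _ P hPmem with hPc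
  set T : Module.End ℂ (ℂ ⊗[ℚ] V) := (Module.End.eigenspace (φ.baseChange ℂ) (-μ)).subtype ∘ₗ f ∘ₗ Pc with hTdef
  have hTw : ∀ w : Module.End.eigenspace (φ.baseChange ℂ) μ, T w = f w := fun w => by
    have hPw : Pc (w : ℂ ⊗[ℚ] V) = w := Subtype.ext (by rw [hPc, LinearMap.codRestrict_apply]; exact hPid w w.2)
    rw [hTdef, LinearMap.comp_apply, LinearMap.comp_apply, hPw, Submodule.subtype_apply]
  have hXW : ∀ X ∈ 𝔤, ∀ w ∈ Module.End.eigenspace (φ.baseChange ℂ) μ,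
      X.baseChange ℂ w ∈ Module.End.eigenspace (φ.baseChange ℂ) μ := fun X hX w hw =>
    UnitaryTheta.apply_mem_eigenspace_of_commute (UnitaryTheta.baseChange_commute H hφE hcomm hX) hw
  have hT : ∀ X ∈ 𝔤, ∀ w ∈ Module.End.eigenspace (φ.baseChange ℂ) μ, T (X.baseChange ℂ w) = X.baseChange ℂ (T w) := by
    intro X hX w hw
    have h1 := hTw ⟨X.baseChange ℂ w, hXW X hX w hw⟩
    have h2 := hTw ⟨w, hw⟩
    simp only at h1 h2
    rw [h1, h2]
    exact hf X hX ⟨w, hw⟩ ⟨X.baseChange ℂ w, hXW X hX w hw⟩ rfl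
  have hmaps : ∀ w ∈ Module.End.eigenspace (φ.baseChange ℂ) μ, T w ∈ Module.End.eigenspace (φ.baseChange ℂ) (-μ) :=
    fun w hw => by rw [hTw ⟨w, hw⟩]; exact (f ⟨w, hw⟩).2
  refine LinearMap.ext fun w => Subtype.ext ?_
  rw [LinearMap.zero_apply, Submodule.coe_zero, ← hTw w]
  exact CentralEigen.eq_zero_of_forall_apply_comm_of_mapsTo_eigenspace_neg H hφE hφ hd hφ2 hμ 𝔤 hΘ hΘ𝔤 hcomm hT hmaps w.2

/-- **`Hom_𝔤(W, W̄) = 0` for `End_Hdg(V) = ℚ + ℚφ`** (`= K = ℚ(√-d)`, the setting of the cell's unitary files: the centrality of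
`φ` is then automatic). [cite: MoonenZarhin1999LowDim, §3 proof of Lemma (3.4) and §2 (2.3)] -/
theorem CentralEigen.linearMap_eigenspace_eq_zero_of_endAlg_eq (H : HodgeStructure V n) {φ : Module.End ℚ V}
    (hφE : φ ∈ H.endAlg) {d : ℚ} (hd : 0 < d) (hφ2 : φ * φ = -(d • 1))
    (hE : ∀ a ∈ H.endAlg, ∃ x y : ℚ, a = x • 1 + y • φ) {μ : ℂ} (hμ : μ ^ 2 = -(d : ℂ))
    (𝔤 : Submodule ℚ (Module.End ℚ V)) {Θ : Module.End ℂ (ℂ ⊗[ℚ] V)}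
    (hΘ : ∀ p, ∀ x ∈ H.piece p (n - p), Θ x = ((2 * p - n : ℤ) : ℂ) • x) (hΘ𝔤 : Θ ∈ spanC 𝔤)
    (hcomm : ∀ X ∈ 𝔤, ∀ a : H.endAlg, X * (a : Module.End ℚ V) = (a : Module.End ℚ V) * X)
    (f : Module.End.eigenspace (φ.baseChange ℂ) μ →ₗ[ℂ] Module.End.eigenspace (φ.baseChange ℂ) (-μ))
    (hf : ∀ X ∈ 𝔤, ∀ w w₁ : Module.End.eigenspace (φ.baseChange ℂ) μ,
      (w₁ : ℂ ⊗[ℚ] V) = X.baseChange ℂ w → (f w₁ : ℂ ⊗[ℚ] V) = X.baseChange ℂ (f w)) :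
    f = 0 := by
  refine CentralEigen.linearMap_eigenspace_eq_zero H hφE (fun a ha => ?_) hd hφ2 hμ 𝔤 hΘ hΘ𝔤 hcomm f hf
  obtain ⟨x, y, rfl⟩ := hE a ha
  rw [add_mul, mul_add, smul_mul_assoc, mul_smul_comm, one_mul, mul_one, smul_mul_assoc, mul_smul_comm]

variable [HodgeTensorFacts.{u, u}]

/-- **`Hom_{Lie Hg}(W, W̄) = 0`** — the linear-map form for `𝔤 = Lie Hg(H)` (bracket-closed, `Θ ∈ (Lie Hg)_ℂ` by
`exists_hodgeTheta` / `mem_hodgeLieC_of_forall_piece`, commuting with `End_Hdg` by `commute_of_mem_hodgeLie`): every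
`ℂ`-linear `f : W → W̄` with `f(X_ℂ w) = X_ℂ f(w)` for all `X ∈ Lie Hg(H)` is zero, for `φ ∈ End_Hdg(V)` central with
`φ² = -d`. This is the input `hHom` of W3 for the (3|3)-square's Weil leg. [cite: MoonenZarhin1999LowDim, §3 proof of Lemma (3.4)]
[cite: Hazama1983, §3 (p. 305)] [cite: Zarhin1983HodgeGroupsK3, §2] -/
theorem CentralEigen.linearMap_eigenspace_eq_zero_hodgeLie (H : HodgeStructure V n) {φ : Module.End ℚ V}
    (hφE : φ ∈ H.endAlg) (hφ : ∀ a ∈ H.endAlg, a * φ = φ * a) {d : ℚ} (hd : 0 < d) (hφ2 : φ * φ = -(d • 1))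
    {μ : ℂ} (hμ : μ ^ 2 = -(d : ℂ))
    (f : Module.End.eigenspace (φ.baseChange ℂ) μ →ₗ[ℂ] Module.End.eigenspace (φ.baseChange ℂ) (-μ))
    (hf : ∀ X ∈ H.hodgeLie, ∀ w w₁ : Module.End.eigenspace (φ.baseChange ℂ) μ,
      (w₁ : ℂ ⊗[ℚ] V) = X.baseChange ℂ w → (f w₁ : ℂ ⊗[ℚ] V) = X.baseChange ℂ (f w)) :
    f = 0 := by
  obtain ⟨Θ, hΘ⟩ := exists_hodgeTheta H
  have hΘ𝔤 : Θ ∈ spanC H.hodgeLie := (hodgeLieC_eq_spanC H) ▸ H.mem_hodgeLieC_of_forall_piece hΘ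
  exact CentralEigen.linearMap_eigenspace_eq_zero H hφE hφ hd hφ2 hμ H.hodgeLie hΘ hΘ𝔤
    (fun X hX a => H.commute_of_mem_hodgeLie hX a) f hf

end Quadratic

end HodgeStructure

end Literature.AlgebraicGeometry.Motives

end
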